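import Literature.MathematicalPhysics.QuantumFieldTheory.Balaban1983to89.B1Eq324BenfattoKernelOfPrecision
import Literature.MathematicalPhysics.QuantumFieldTheory.Balaban1983to89.B1Eq324BenfattoCondKernelGeneric
import Literature.MathematicalPhysics.QuantumFieldTheory.Balaban1983to89.B1Eq324BenfattoSect5Iteration
import HarnessLib

/-!
# `Balaban1983to89.B1Eq324BenfattoKernelSect5Iteration` — [BenfattoEtAl1978] §5 p. 159 «a new pavement displaced by b²/2», FOR THE CLASS of
# [Balaban1985BackgroundPropagators] Sect. E p. 428: translating the datum of (4.7) is COVARIANT for a non-invariant Gaussian field — the translated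
# integral is the original one under the Gaussian field of the SHIFTED PRECISION, which is a member of the same class with the same constants, PROVED

statement-level skeleton of published theorems with citation tags; proofs where landed; nothing here is a claim about the
Yang–Mills mass gap

WHY THIS MODULE (cell `pub-ymgap`, seat `dag-n08-d` gen 13, INTENT-55; node N08 [Balaban1985UV3]; the [BenfattoEtAl1978] source chain behind the
(α)-row `h324`; row S5 of `N08-PORT-MAP-STRUCTURAL-SIDE.md`).  The concrete `…Sect5Iteration.integral_cutoffBoltzmann_translate` moves the datum
`(J + σ, I + σ, A, b)` of the left side of (4.7) back to `(J, I, shiftCoef A σ, b)` using the TRANSLATION INVARIANCE of [2]'s free field `P̂₀` — the one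
use of invariance in the pavement chain (census (T) of n08-c's `N08-BASICLEMMA-KERNEL-CENSUS.md`).  A class kernel is not invariant; but the chain needs
only COVARIANCE: `∫ F(z(·+σ)) dμ_K = ∫ F dμ_{K(·+σ,·+σ)}` (n08-c `…CondKernelGeneric.integral_gaussianFieldOfKernel_comp_add_right`), and the shifted kernel
of the class kernel of `(Λ, A)` IS the class kernel of the shifted precision `(Λ − σ, A(·+σ, ·+σ))`, with the SAME symmetry, coercivity constant `γ_A` and
Combes–Thomas row defect `(J, κ)` (the cube distance is invariant, `…Translation.cubeDist_add_right`).  So the induction datum of a class chain is «a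
member `(Λ_j, A_j)` of the class», and every row of `…KernelSect5Eq515` / `…KernelSect5PavementStep` transports along the steps (free side: seat
n08-b's `…KernelSect5FreeStep` §2 carries the cumulant letters the same way; conditioned level: n08-c's `…KernelCondTranslation`).

WHAT IS PROVED (standard axioms; no `sorry`; no definition).  `σ ∈ Q₀`; `Λ.image (· − σ)` the shifted window; the shifted precision is displayed as
the submatrix `A.submatrix e e` along `e : ↥(Λ.image (· − σ)) → Λ`, `j ↦ j + σ`.
* §1 `mem_image_sub_iff` (`x ∈ Λ − σ ↔ x + σ ∈ Λ`), ★ `kernel_translate` (the ROW: `K(x+σ, y+σ) = [x, y ∈ Λ−σ]·((A(·+σ,·+σ))⁻¹)_{xy}` — i.e. `…KernelOfPrecision`'s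
  `hK` for `(Λ − σ, A.submatrix e e)`, via `Matrix.inv_submatrix_equiv`), `submatrix_translate_symm`, `submatrix_translate_coercive` (same `γ_A`),
  `submatrix_translate_rowDefect_le` (same `(J, κ)` for `cubeDist`), `submatrix_translate_absRow_le` (any `cubeDist`-weighted absolute row bound transports).
* §2 ★★ `integral_cutoffBoltzmann_translate` — THE CLASS TWIN: for every positive-semidefinite kernel `G` on `Q₀`,
  `∫ Π_Δχ̂^{I+σ}_Δ e^{H^A_{J+σ}} dμ_G = ∫ Π_Δχ̂^{I}_Δ e^{H^{shiftCoef A σ}_J} dμ_{G(·+σ,·+σ)}`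
  (`…Sect5Iteration.cutoffBoltzmann_translate` pointwise + covariance); `integral_comp_translate` (any measurable `F`).
HONEST SCOPE.  Transport lemmas (a push-forward and finite-dimensional re-indexing); nothing of the §5 chain beyond the translation step is ported here;
the class and its use are OURS, not print; nothing of [Balaban1985UV3] / [Balaban1985UV2] is asserted; no generalised Basic Lemma is stated; count-neutral
for N08; nothing about d = 4, the continuum, OS axioms, a mass gap or the Clay problem.
-/

noncomputable section

open MeasureTheory ProbabilityTheory Finset Matrix
open scoped BigOperators Matrix

namespace Literature.MathematicalPhysics.QuantumFieldTheory.Balaban1983to89.B1Eq324BenfattoKernelSect5Iteration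

open Literature.MathematicalPhysics.QuantumFieldTheory
open Literature.MathematicalPhysics.QuantumFieldTheory.Balaban1983to89.B1Eq324BenfattoLemma
open Literature.MathematicalPhysics.QuantumFieldTheory.Balaban1983to89.B1Eq324BenfattoKernelOfPrecision
open Literature.MathematicalPhysics.QuantumFieldTheory.Balaban1983to89.B1Eq324BenfattoCondKernelGeneric (integral_gaussianFieldOfKernel_comp_add_right)
open Literature.MathematicalPhysics.QuantumFieldTheory.Balaban1983to89.B1Eq324BenfattoTranslation (cubeDist_add_right)
open Literature.MathematicalPhysics.QuantumFieldTheory.Balaban1983to89.B1Eq324BenfattoSect5Iteration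

variable {d : ℕ}

/-! ## §1  The class is shift-closed: the shifted class kernel is the class kernel of the shifted precision, with the same constants -/

section ShiftClosed

variable {Λ : Finset (B1Eq324BenfattoLemma.Site d)} (σ : B1Eq324BenfattoLemma.Site d)

/-- `x ∈ Λ − σ ↔ x + σ ∈ Λ` (the shifted window). [folklore] [cite: BenfattoEtAl1978, p.159 «a new pavement displaced by b²/2» (class form)] -/
theorem mem_image_sub_iff {x : B1Eq324BenfattoLemma.Site d} : x ∈ Λ.image (fun y => y - σ) ↔ x + σ ∈ Λ := by
  constructor
  · intro hx
    obtain ⟨y, hy, rfl⟩ := Finset.mem_image.mp hx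
    rwa [sub_add_cancel]
  · intro hx
    exact Finset.mem_image.mpr ⟨x + σ, hx, add_sub_cancel_right x σ⟩

variable {A : Matrix Λ Λ ℝ} {K : B1Eq324BenfattoLemma.Site d → B1Eq324BenfattoLemma.Site d → ℝ}
  (hK : ∀ x y, K x y = if h : x ∈ Λ ∧ y ∈ Λ then (A⁻¹ : Matrix Λ Λ ℝ) ⟨x, h.1⟩ ⟨y, h.2⟩ else 0)

include hK

/-- **THE CLASS IS SHIFT-CLOSED — the row**: the shifted kernel `K(·+σ, ·+σ)` of the class kernel of `(Λ, A)` is the class kernel of the shifted precision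
`(Λ − σ, A(·+σ, ·+σ))`: `K(x+σ, y+σ) = [x, y ∈ Λ−σ]·((A.submatrix e e)⁻¹)_{xy}`, `e j = j + σ` — `…KernelOfPrecision`'s hypothesis `hK` for the shifted
data, so every class theorem applies to `μ_{K(·+σ,·+σ)}` by instantiation. [cite: BenfattoEtAl1978, p.159 (class form; ours)] -/
theorem kernel_translate (x y : B1Eq324BenfattoLemma.Site d) :
    K (x + σ) (y + σ) =
      if h : x ∈ Λ.image (fun y => y - σ) ∧ y ∈ Λ.image (fun y => y - σ) then
        ((A.submatrix (fun j : ↥(Λ.image fun y => y - σ) => (⟨(j : B1Eq324BenfattoLemma.Site d) + σ, (mem_image_sub_iff σ).mp j.2⟩ : Λ))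
            (fun j : ↥(Λ.image fun y => y - σ) => (⟨(j : B1Eq324BenfattoLemma.Site d) + σ, (mem_image_sub_iff σ).mp j.2⟩ : Λ)))⁻¹ :
          Matrix ↥(Λ.image fun y => y - σ) ↥(Λ.image fun y => y - σ) ℝ) ⟨x, h.1⟩ ⟨y, h.2⟩
      else 0 := by
  classical
  -- the re-indexing is an equivalence `Λ − σ ≃ Λ`
  let e : ↥(Λ.image fun y => y - σ) ≃ Λ :=
    { toFun := fun j => ⟨(j : B1Eq324BenfattoLemma.Site d) + σ, (mem_image_sub_iff σ).mp j.2⟩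
      invFun := fun k => ⟨(k : B1Eq324BenfattoLemma.Site d) - σ, Finset.mem_image.mpr ⟨k, k.2, rfl⟩⟩
      left_inv := fun j => Subtype.ext (add_sub_cancel_right _ _)
      right_inv := fun k => Subtype.ext (sub_add_cancel _ _) }
  have hsub : A.submatrix (fun j : ↥(Λ.image fun y => y - σ) => (⟨(j : B1Eq324BenfattoLemma.Site d) + σ, (mem_image_sub_iff σ).mp j.2⟩ : Λ))
      (fun j : ↥(Λ.image fun y => y - σ) => (⟨(j : B1Eq324BenfattoLemma.Site d) + σ, (mem_image_sub_iff σ).mp j.2⟩ : Λ)) = A.submatrix e e := rfl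
  by_cases hx : x + σ ∈ Λ
  · by_cases hy : y + σ ∈ Λ
    · have hx' : x ∈ Λ.image (fun y => y - σ) := (mem_image_sub_iff σ).mpr hx
      have hy' : y ∈ Λ.image (fun y => y - σ) := (mem_image_sub_iff σ).mpr hy
      rw [hK, dif_pos ⟨hx, hy⟩, dif_pos ⟨hx', hy'⟩, hsub, Matrix.inv_submatrix_equiv]
      rfl
    · have hy' : y ∉ Λ.image (fun y => y - σ) := fun h => hy ((mem_image_sub_iff σ).mp h)
      rw [hK, dif_neg (fun h => hy h.2), dif_neg (fun h => hy' h.2)]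
  · have hx' : x ∉ Λ.image (fun y => y - σ) := fun h => hx ((mem_image_sub_iff σ).mp h)
    rw [hK, dif_neg (fun h => hx h.1), dif_neg (fun h => hx' h.1)]

omit hK in
/-- The shifted precision is symmetric if `A` is. [folklore] [cite: BenfattoEtAl1978, p.159 (class form)] -/
theorem submatrix_translate_symm (hAs : ∀ e e', A e e' = A e' e) :
    ∀ e e' : ↥(Λ.image fun y => y - σ),
      A.submatrix (fun j : ↥(Λ.image fun y => y - σ) => (⟨(j : B1Eq324BenfattoLemma.Site d) + σ, (mem_image_sub_iff σ).mp j.2⟩ : Λ))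
        (fun j : ↥(Λ.image fun y => y - σ) => (⟨(j : B1Eq324BenfattoLemma.Site d) + σ, (mem_image_sub_iff σ).mp j.2⟩ : Λ)) e e' =
      A.submatrix (fun j : ↥(Λ.image fun y => y - σ) => (⟨(j : B1Eq324BenfattoLemma.Site d) + σ, (mem_image_sub_iff σ).mp j.2⟩ : Λ))
        (fun j : ↥(Λ.image fun y => y - σ) => (⟨(j : B1Eq324BenfattoLemma.Site d) + σ, (mem_image_sub_iff σ).mp j.2⟩ : Λ)) e' e :=
  fun _ _ => hAs _ _

omit hK in
/-- **The shifted precision has the same coercivity constant `γ_A`** (the quadratic form is re-indexed along a bijection). [folklore]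
[cite: BenfattoEtAl1978, p.159 (class form)] -/
theorem submatrix_translate_coercive {γ : ℝ} (hγ : ∀ x : Λ → ℝ, γ * ∑ e, x e ^ 2 ≤ ∑ e, ∑ e', A e e' * x e * x e') :
    ∀ v : ↥(Λ.image fun y => y - σ) → ℝ, γ * ∑ e, v e ^ 2 ≤
      ∑ e, ∑ e', A.submatrix (fun j : ↥(Λ.image fun y => y - σ) => (⟨(j : B1Eq324BenfattoLemma.Site d) + σ, (mem_image_sub_iff σ).mp j.2⟩ : Λ))
        (fun j : ↥(Λ.image fun y => y - σ) => (⟨(j : B1Eq324BenfattoLemma.Site d) + σ, (mem_image_sub_iff σ).mp j.2⟩ : Λ)) e e' * v e * v e' := by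
  classical
  intro v
  let e : ↥(Λ.image fun y => y - σ) ≃ Λ :=
    { toFun := fun j => ⟨(j : B1Eq324BenfattoLemma.Site d) + σ, (mem_image_sub_iff σ).mp j.2⟩
      invFun := fun k => ⟨(k : B1Eq324BenfattoLemma.Site d) - σ, Finset.mem_image.mpr ⟨k, k.2, rfl⟩⟩
      left_inv := fun j => Subtype.ext (add_sub_cancel_right _ _)
      right_inv := fun k => Subtype.ext (sub_add_cancel _ _) }
  -- transport the vector `v` to `Λ` along `e`
  have h := hγ (fun k => v (e.symm k))
  have h1 : ∑ k : Λ, (fun k => v (e.symm k)) k ^ 2 = ∑ j, v j ^ 2 := by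
    rw [← e.sum_comp]
    simp only [Equiv.symm_apply_apply]
  have h2 : ∑ k : Λ, ∑ k' : Λ, A k k' * (fun k => v (e.symm k)) k * (fun k => v (e.symm k)) k' =
      ∑ j, ∑ j', A.submatrix e e j j' * v j * v j' := by
    rw [← e.sum_comp]
    refine Finset.sum_congr rfl fun j _ => ?_
    rw [← e.sum_comp]
    simp only [Equiv.symm_apply_apply, Matrix.submatrix_apply]
  rw [h1, h2] at h
  exact h

omit hK in
/-- **The shifted precision has the same Combes–Thomas row defect** for the (translation-invariant) cube distance: if
`Σ_{e′}|A e e′|(cosh(κ·d(e,e′)) − 1) ≤ J` on `Λ` then the same holds for `A(·+σ,·+σ)` on `Λ − σ`. [folklore]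
[cite: BenfattoEtAl1978, p.159; after (2.3) p.146 (class form)] -/
theorem submatrix_translate_rowDefect_le {κ J : ℝ}
    (hJ : ∀ e : Λ, ∑ e' : Λ, |A e e'| * (Real.cosh (κ * cubeDist (e : B1Eq324BenfattoLemma.Site d) (e' : B1Eq324BenfattoLemma.Site d)) - 1) ≤ J) :
    ∀ e : ↥(Λ.image fun y => y - σ), ∑ e' : ↥(Λ.image fun y => y - σ),
      |A.submatrix (fun j : ↥(Λ.image fun y => y - σ) => (⟨(j : B1Eq324BenfattoLemma.Site d) + σ, (mem_image_sub_iff σ).mp j.2⟩ : Λ))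
          (fun j : ↥(Λ.image fun y => y - σ) => (⟨(j : B1Eq324BenfattoLemma.Site d) + σ, (mem_image_sub_iff σ).mp j.2⟩ : Λ)) e e'| *
        (Real.cosh (κ * cubeDist (e : B1Eq324BenfattoLemma.Site d) (e' : B1Eq324BenfattoLemma.Site d)) - 1) ≤ J := by
  classical
  intro j
  let e : ↥(Λ.image fun y => y - σ) ≃ Λ :=
    { toFun := fun j => ⟨(j : B1Eq324BenfattoLemma.Site d) + σ, (mem_image_sub_iff σ).mp j.2⟩
      invFun := fun k => ⟨(k : B1Eq324BenfattoLemma.Site d) - σ, Finset.mem_image.mpr ⟨k, k.2, rfl⟩⟩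
      left_inv := fun j => Subtype.ext (add_sub_cancel_right _ _)
      right_inv := fun k => Subtype.ext (sub_add_cancel _ _) }
  have h := hJ (e j)
  have hre : ∑ e' : Λ, |A (e j) e'| * (Real.cosh (κ * cubeDist ((e j : Λ) : B1Eq324BenfattoLemma.Site d) (e' : B1Eq324BenfattoLemma.Site d)) - 1) =
      ∑ j' : ↥(Λ.image fun y => y - σ), |A (e j) (e j')| *
        (Real.cosh (κ * cubeDist ((e j : Λ) : B1Eq324BenfattoLemma.Site d) ((e j' : Λ) : B1Eq324BenfattoLemma.Site d)) - 1) := by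
    rw [← e.sum_comp]
  rw [hre] at h
  refine le_trans (le_of_eq (Finset.sum_congr rfl fun j' _ => ?_)) h
  have hj : ((e j : Λ) : B1Eq324BenfattoLemma.Site d) = (j : B1Eq324BenfattoLemma.Site d) + σ := rfl
  have hj' : ((e j' : Λ) : B1Eq324BenfattoLemma.Site d) = (j' : B1Eq324BenfattoLemma.Site d) + σ := rfl
  rw [hj, hj', cubeDist_add_right]
  rfl

omit hK in
/-- **Any `cubeDist`-weighted absolute row bound transports** to the shifted precision (e.g. the growth rows `hM`, `hV`-type data of J1 F5/F7).
[folklore] [cite: BenfattoEtAl1978, p.159 (class form)] -/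
theorem submatrix_translate_absRow_le {M : ℝ} (φ : ℝ → ℝ)
    (hM : ∀ e : Λ, ∑ e' : Λ, |A e e'| * φ (cubeDist (e : B1Eq324BenfattoLemma.Site d) (e' : B1Eq324BenfattoLemma.Site d)) ≤ M) :
    ∀ e : ↥(Λ.image fun y => y - σ), ∑ e' : ↥(Λ.image fun y => y - σ),
      |A.submatrix (fun j : ↥(Λ.image fun y => y - σ) => (⟨(j : B1Eq324BenfattoLemma.Site d) + σ, (mem_image_sub_iff σ).mp j.2⟩ : Λ))
          (fun j : ↥(Λ.image fun y => y - σ) => (⟨(j : B1Eq324BenfattoLemma.Site d) + σ, (mem_image_sub_iff σ).mp j.2⟩ : Λ)) e e'| *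
        φ (cubeDist (e : B1Eq324BenfattoLemma.Site d) (e' : B1Eq324BenfattoLemma.Site d)) ≤ M := by
  classical
  intro j
  let e : ↥(Λ.image fun y => y - σ) ≃ Λ :=
    { toFun := fun j => ⟨(j : B1Eq324BenfattoLemma.Site d) + σ, (mem_image_sub_iff σ).mp j.2⟩
      invFun := fun k => ⟨(k : B1Eq324BenfattoLemma.Site d) - σ, Finset.mem_image.mpr ⟨k, k.2, rfl⟩⟩
      left_inv := fun j => Subtype.ext (add_sub_cancel_right _ _)
      right_inv := fun k => Subtype.ext (sub_add_cancel _ _) }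
  have h := hM (e j)
  have hre : ∑ e' : Λ, |A (e j) e'| * φ (cubeDist ((e j : Λ) : B1Eq324BenfattoLemma.Site d) (e' : B1Eq324BenfattoLemma.Site d)) =
      ∑ j' : ↥(Λ.image fun y => y - σ), |A (e j) (e j')| * φ (cubeDist ((e j : Λ) : B1Eq324BenfattoLemma.Site d) ((e j' : Λ) : B1Eq324BenfattoLemma.Site d)) := by
    rw [← e.sum_comp]
  rw [hre] at h
  refine le_trans (le_of_eq (Finset.sum_congr rfl fun j' _ => ?_)) h
  have hj : ((e j : Λ) : B1Eq324BenfattoLemma.Site d) = (j : B1Eq324BenfattoLemma.Site d) + σ := rfl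
  have hj' : ((e j' : Λ) : B1Eq324BenfattoLemma.Site d) = (j' : B1Eq324BenfattoLemma.Site d) + σ := rfl
  rw [hj, hj', cubeDist_add_right]
  rfl

end ShiftClosed

/-! ## §2  Translating the datum of (4.7) is covariant: the §5 integral under `μ_G` equals the un-translated one under `μ_{G(·+σ,·+σ)}` -/

section Translate

variable {G : B1Eq324BenfattoLemma.Site d → B1Eq324BenfattoLemma.Site d → ℝ} {s D : ℕ} {κ : ℝ} {a : Coef d}

/-- **Covariance of the field integral under a lattice translation** (any measurable observable): `∫ F(z(·+σ)) dμ_G = ∫ F dμ_{G(·+σ,·+σ)}` — n08-c's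
`integral_gaussianFieldOfKernel_comp_add_right`, re-exported in this file's vocabulary. [cite: BenfattoEtAl1978, p.159 (class form)] -/
theorem integral_comp_translate (hG : IsPosSemidefKernel G) (σ : B1Eq324BenfattoLemma.Site d) {F : (B1Eq324BenfattoLemma.Site d → ℝ) → ℝ} (hF : Measurable F) :
    ∫ z, F (fun x => z (x + σ)) ∂gaussianFieldOfKernel G = ∫ z, F z ∂gaussianFieldOfKernel (fun x y => G (x + σ) (y + σ)) :=
  integral_gaussianFieldOfKernel_comp_add_right hG σ hF

/-- **DISPLACED PAVEMENTS, FOR THE CLASS — THE LEFT SIDE OF (4.7) FOR A TRANSLATED DATUM**: for every positive-semidefinite kernel `G` on `Q₀`,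
`∫ Π_Δχ̂^{I+σ}_Δ e^{H^A_{J+σ}} dμ_G = ∫ Π_Δχ̂^{I}_Δ e^{H^{shiftCoef A σ}_J} dμ_{G(·+σ,·+σ)}` — the datum `(J + σ, I + σ, A, b)` under `μ_G` is the datum
`(J, I, shiftCoef A σ, b)` under the field of the SHIFTED kernel (for the class kernel of `(Λ, A)`: the class kernel of `(Λ − σ, A(·+σ,·+σ))`, §1); so the
corridor theorems, stated for tesserae cornered on `Lℤ^d`, apply to a pavement displaced by `−σ` after translating the datum by `σ` AND replacing the class
member by its shift.  The free-field statement replaced is `…Sect5Iteration.integral_cutoffBoltzmann_translate` (there `μ_{G(·+σ,·+σ)} = μ_G`).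
[cite: BenfattoEtAl1978, p.159 «a new pavement displaced by b²/2» (class form; ours)] -/
theorem integral_cutoffBoltzmann_translate (hG : IsPosSemidefKernel G) (J I : Finset (B1Eq324BenfattoLemma.Site d)) (b : ℝ) (σ : B1Eq324BenfattoLemma.Site d) :
    ∫ z, cutoffBoltzmann (hamiltonian s D κ a (J.image fun x => x + σ)) (I.image fun x => x + σ) b z ∂gaussianFieldOfKernel G =
      ∫ z, cutoffBoltzmann (hamiltonian s D κ (shiftCoef a σ) J) I b z ∂gaussianFieldOfKernel (fun x y => G (x + σ) (y + σ)) := by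
  simp only [cutoffBoltzmann_translate]
  exact integral_comp_translate hG σ (measurable_cutoffBoltzmann_hamiltonian (shiftCoef a σ) J I b)

end Translate

end Literature.MathematicalPhysics.QuantumFieldTheory.Balaban1983to89.B1Eq324BenfattoKernelSect5Iteration

end
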